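import Literature.RepresentationTheory.ModularTensorCategories.Pointed

/-!
# Modularity of the pointed data `ℤ_N^{(p)}` for `2p` invertible mod `N`

Topic `Literature/RepresentationTheory/ModularTensorCategories` (definition item `defn-ModularDatum`: the
abelian instances wanted by route `QuantumFields/ModularSelfDualFold` — "Abelian case (C pointed:
ℤ_N^{(p)}) reduces to the self-duality of ℤ_N gauge theory").

For the bicharacter datum `zmodPointed N p` (braiding `R^{ab}_{a+b} = e(p ab/N)`, `θ_a = e(p a²/N)`)
the S-matrix is `S_{ab} = N^{-1/2} e(-2p·ab/N)` (`zmodPointed_S_apply`), so it is unitary exactly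
when `2p` is a unit of `ZMod N`; in that case we verify directly (orthogonality of the primitive
additive character of `ZMod N`, `AddChar.sum_mulShift`) unitarity of `S`, `S² = C` (`C_{ab} = δ_{a,-b}`)
and the Verlinde formula, i.e. `zmodPointedModular N p h : ModularDatum (ZMod N)`.
References: Bonderson–Shtengel–Slingerland §3.6.1 (`S_{ab} = N^{-1/2} e^{4πi w ab/N}` up to complex
conjugation, `𝒟 = √N`); Gannon Def. 6.1.6 / (6.1.1b) for what is being verified.
-/

noncomputable section

open scoped ComplexConjugate Matrix

namespace Literature.RepresentationTheory.ModularTensorCategories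

variable {N : ℕ} [NeZero N]

/-- `conj e(j/N) = e(-j/N)` for the standard additive character of `ZMod N`. [folklore] -/
theorem stdAddChar_conj (j : ZMod N) : conj (ZMod.stdAddChar j : ℂ) = ZMod.stdAddChar (-j) := by
  rw [ZMod.stdAddChar_apply, ZMod.stdAddChar_apply, AddChar.map_neg_eq_inv, Circle.coe_inv_eq_conj]

/-- `e(x) e(y) = e(x + y)`. [folklore] -/
theorem stdAddChar_mul (x y : ZMod N) :
    (ZMod.stdAddChar x : ℂ) * ZMod.stdAddChar y = ZMod.stdAddChar (x + y) :=
  (AddChar.map_add_eq_mul _ x y).symm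

/-- Orthogonality: `Σ_x e(x b / N) = N [b = 0]`. [folklore] -/
theorem sum_stdAddChar_mul (b : ZMod N) :
    ∑ x : ZMod N, (ZMod.stdAddChar (x * b) : ℂ) = if b = 0 then (N : ℂ) else 0 := by
  rw [AddChar.sum_mulShift b (ZMod.isPrimitive_stdAddChar N), ZMod.card]
  split_ifs <;> simp

/-- The S-matrix of `ℤ_N^{(p)}`: `S_{ab} = N^{-1/2} e(-2p ab / N)`.
[cite: BondersonShtengelSlingerland2008, §3.6.1 (S_ab = N^{-1/2} e^{i 4π w ab/N}, printed in the conjugate convention)] -/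
theorem zmodPointed_S_apply (p : ℤ) (a b : ZMod N) :
    (zmodPointed N p).S a b =
      (ZMod.stdAddChar (-(2 * (p : ZMod N) * a * b)) : ℂ) / (Real.sqrt N : ℂ) := by
  change (ZMod.stdAddChar ((p : ZMod N) * (a - b) * (a - b)) : ℂ) /
      (ZMod.stdAddChar ((p : ZMod N) * a * a) * ZMod.stdAddChar ((p : ZMod N) * b * b)) /
      (Real.sqrt (Fintype.card (ZMod N)) : ℂ) = _
  have hne : ∀ z : ZMod N, (ZMod.stdAddChar z : ℂ) ≠ 0 := fun z hz => by
    simpa [hz] using AddChar.norm_apply (ZMod.stdAddChar (N := N)) z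
  rw [ZMod.card]
  congr 1
  rw [div_eq_iff (mul_ne_zero (hne _) (hne _)), stdAddChar_mul, stdAddChar_mul]
  congr 1
  ring

variable (N)

/-- **`ℤ_N^{(p)}` is modular when `2p` is invertible mod `N`**: unitarity of `S`, `S² = C` and the
Verlinde formula for `zmodPointed N p`, verified by character orthogonality on `ZMod N`.
[cite: BondersonShtengelSlingerland2008, §3.6.1 (ℤ_N^{(w)} data, 𝒟 = √N)]
[cite: Gannon2023, Def. 6.1.6 and eq. (6.1.1b) (unitarity of S and the Verlinde formula being verified)] -/
def zmodPointedModular (p : ℤ) (h2p : IsUnit (2 * (p : ZMod N))) : ModularDatum (ZMod N) where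
  toPreModularDatum := zmodPointed N p
  S_unitary := by
    have hN : (Real.sqrt N : ℂ) ≠ 0 := by
      exact_mod_cast (Real.sqrt_pos.mpr (by exact_mod_cast Nat.pos_of_ne_zero (NeZero.ne N))).ne'
    have hNN : (Real.sqrt N : ℂ) * Real.sqrt N = N := by
      rw [← Complex.ofReal_mul, Real.mul_self_sqrt (Nat.cast_nonneg N)]; simp
    ext a c
    rw [Matrix.mul_apply]
    simp only [Matrix.conjTranspose_apply, zmodPointed_S_apply, star_div₀, Complex.star_def,
      stdAddChar_conj, Complex.conj_ofReal, neg_neg]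
    have hterm : ∀ x : ZMod N,
        (ZMod.stdAddChar (-(2 * (p : ZMod N) * a * x)) : ℂ) / (Real.sqrt N : ℂ) *
          ((ZMod.stdAddChar (2 * (p : ZMod N) * c * x) : ℂ) / (Real.sqrt N : ℂ)) =
        (ZMod.stdAddChar (x * (2 * (p : ZMod N) * (c - a))) : ℂ) / N := fun x => by
      rw [div_mul_div_comm, stdAddChar_mul, hNN]
      congr 2
      ring
    simp_rw [hterm, ← Finset.sum_div, sum_stdAddChar_mul, Matrix.one_apply]
    have hiff : 2 * (p : ZMod N) * (c - a) = 0 ↔ a = c := by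
      rw [h2p.mul_right_eq_zero, sub_eq_zero, eq_comm]
    by_cases hac : a = c
    · rw [if_pos (hiff.mpr hac), if_pos hac, div_self]
      exact_mod_cast NeZero.ne N
    · rw [if_neg (fun h => hac (hiff.mp h)), if_neg hac, zero_div]
  S_mul_S := by
    have hNN : (Real.sqrt N : ℂ) * Real.sqrt N = N := by
      rw [← Complex.ofReal_mul, Real.mul_self_sqrt (Nat.cast_nonneg N)]; simp
    ext a c
    rw [Matrix.mul_apply, Matrix.of_apply]
    simp only [zmodPointed_S_apply]
    have hterm : ∀ x : ZMod N,
        (ZMod.stdAddChar (-(2 * (p : ZMod N) * a * x)) : ℂ) / (Real.sqrt N : ℂ) *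
          ((ZMod.stdAddChar (-(2 * (p : ZMod N) * x * c)) : ℂ) / (Real.sqrt N : ℂ)) =
        (ZMod.stdAddChar (x * (-(2 * (p : ZMod N) * (a + c)))) : ℂ) / N := fun x => by
      rw [div_mul_div_comm, stdAddChar_mul, hNN]
      congr 2
      ring
    simp_rw [hterm, ← Finset.sum_div, sum_stdAddChar_mul]
    have hiff : -(2 * (p : ZMod N) * (a + c)) = 0 ↔ a = -c := by
      rw [neg_eq_zero, h2p.mul_right_eq_zero, add_eq_zero_iff_eq_neg]
    change _ = if a = (zmodPointed N p).dual c then (1 : ℂ) else 0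
    rw [show (zmodPointed N p).dual c = -c from rfl]
    by_cases hac : a = -c
    · rw [if_pos (hiff.mpr hac), if_pos hac, div_self]
      exact_mod_cast NeZero.ne N
    · rw [if_neg (fun h => hac (hiff.mp h)), if_neg hac, zero_div]
  verlinde := by
    have hN : (Real.sqrt N : ℂ) ≠ 0 := by
      exact_mod_cast (Real.sqrt_pos.mpr (by exact_mod_cast Nat.pos_of_ne_zero (NeZero.ne N))).ne'
    have hNN : (Real.sqrt N : ℂ) * Real.sqrt N = N := by
      rw [← Complex.ofReal_mul, Real.mul_self_sqrt (Nat.cast_nonneg N)]; simp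
    intro a b c
    simp only [zmodPointed_S_apply]
    change ((if c = a + b then (1 : ℕ) else 0 : ℕ) : ℂ) = _
    rw [show (zmodPointed N p).unit = 0 from rfl]
    have hterm : ∀ x : ZMod N,
        (ZMod.stdAddChar (-(2 * (p : ZMod N) * a * x)) : ℂ) / (Real.sqrt N : ℂ) *
            ((ZMod.stdAddChar (-(2 * (p : ZMod N) * b * x)) : ℂ) / (Real.sqrt N : ℂ)) *
            conj ((ZMod.stdAddChar (-(2 * (p : ZMod N) * c * x)) : ℂ) / (Real.sqrt N : ℂ)) /
          ((ZMod.stdAddChar (-(2 * (p : ZMod N) * 0 * x)) : ℂ) / (Real.sqrt N : ℂ)) =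
        (ZMod.stdAddChar (x * (2 * (p : ZMod N) * (c - a - b))) : ℂ) / N := fun x => by
      rw [map_div₀, Complex.conj_ofReal, stdAddChar_conj, neg_neg]
      simp only [mul_zero, zero_mul, neg_zero, AddChar.map_zero_eq_one]
      rw [div_mul_div_comm, div_mul_div_comm, div_div_eq_mul_div, div_one, div_mul_eq_mul_div,
        mul_div_mul_right _ _ hN, hNN, stdAddChar_mul, stdAddChar_mul]
      congr 2
      ring
    simp_rw [hterm, ← Finset.sum_div, sum_stdAddChar_mul]
    have hiff : 2 * (p : ZMod N) * (c - a - b) = 0 ↔ c = a + b := by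
      rw [h2p.mul_right_eq_zero, sub_sub, sub_eq_zero]
    by_cases habc : c = a + b
    · rw [if_pos (hiff.mpr habc), if_pos habc, div_self, Nat.cast_one]
      exact_mod_cast NeZero.ne N
    · rw [if_neg (fun h => habc (hiff.mp h)), if_neg habc, zero_div, Nat.cast_zero]

end Literature.RepresentationTheory.ModularTensorCategories
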